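import Summits.BirchSwinnertonDyer.Rank1Residual.X5.TwoAdicTargetsMultEisenstein
import Summits.BirchSwinnertonDyer.Rank1Residual.X5.TwoAdicTargetsMultPubOdd
import Literature.NumberTheory.EllipticCurves.Greenberg1999.SelmerCotorsionMultiplicative
import Literature.NumberTheory.EllipticCurves.Greenberg1999.EulerCharacteristicNonsplitMultiplicativeAnyPrime
import Literature.NumberTheory.EllipticCurves.Greenberg1999.EulerCharacteristicSplitMultiplicativeAnyPrime
import Literature.NumberTheory.EllipticCurves.ModularCurve
import Literature.NumberTheory.EllipticCurves.Isogeny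
import HarnessLib
import Literature.NumberTheory.EllipticCurves.MultConverseCycPublishedInputsAtTwo

/-!
# Route `TwoAdicConverse` (rung S3), multiplicative branch — the CYCLOTOMIC children of
# `MultiplicativeRankZeroTwoConverse` (item stmt-BirchSwinnertonDyer-19219) as CLOSED `Prop` leaves
# (importable by the route file; no Theses file imported)

Why this file exists (seat bsd-2adic-conv-2 GEN 4, 2026-08-26). `Theorems/TwoAdicConverseMultEisensteinPrint.lean`
(p432672) proves that the crux `MultiplicativeRankZeroTwoConverse` follows from PRINT {Greenberg's "analogue of Thm. 4.1" at a
non-split multiplicative prime in its guarded form (A235-twin, p425330), its split form (A236), modularity (BCDT), Greenberg's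
Thm. 1.5 (Kato–Rohrlich: `X(E/ℚ_∞)` torsion at a multiplicative `p`, p431724)} + MEMO {Greenberg–Stevens at a SPLIT `2`} + ONE
research object — the integral Eisenstein direction of the `2`-adic main conjecture at a multiplicative `2` (T-mult-4-int,
`X5.O1.MultEisensteinDivisibilityAtTwo`), needed only at ONE globally minimal member of each isogeny class
(`multiplicativeRankZeroTwoConverse_of_multEisenstein_of_cotorsion_upToIsogeny`). So that a planner MAY re-split 19219 along
these three children by NAME (symmetric to the good-ordinary rider S-1 of item 19218 over `OrdLambdaHalfAtTwo`,
`Theorems/TwoAdicConverseLambdaHalfDefs.lean`), the three `Prop`s are stated here as constants: the PUB conjunction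
`MultCycPublishedInputsAtTwo` (a `[cite]`d conjunction of Literature facts — relocated by the gate to Literature at acceptance, like
`Literature.Uncategorized.OrdConversePublishedInputsAtTwo`), the memo child `MultGreenbergStevensAtTwo` (`@[conjecture]`: not print at `2`), and the crux in two strengths — member-wise
`MultEisensteinHalfAtTwo` (VERBATIM the object of the K4ᵐ lower-half road, item 19923) and isogeny-hedged
`MultEisensteinHalfAtTwoIso` (the (β) pattern ruled for item 19271: the `μ`-isogeny formula at `p = 2` is not in print, so
the divisibility is asked at SOME minimal member of the class), with the implication between them. NOTHING is asserted;
no `sorry`; no new Literature fact; no instance/notation. The glue theorems by name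
(`multiplicativeRankZeroTwoConverse_of_cycChildren{,Iso}`, `multTwoConverseOverKAtTwo_of_cycChildrenIso`) are landed in a
separate Theorems file once this module is built. PARTITION (D-0054): none — RANK axis (S3 mult); companion formula cell
X5@2 mult (K4ᵐ, B1·O1; 1 976 classes).
-/

set_option linter.dupNamespace false
set_option autoImplicit false

noncomputable section

open scoped MatrixGroups ModularForm
open CongruenceSubgroup WeierstrassCurve Literature.NumberTheory.EllipticCurves
  Literature.NumberTheory.EllipticCurves.ModularForms Literature.NumberTheory.EllipticCurves.Greenberg1999
  Literature.NumberTheory.EllipticCurves.Rank1Residual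

namespace Summit.BirchSwinnertonDyer.BirchSwinnertonDyer.Theorems.TwoAdicMultCyc

/-- **[proposed support child, MEMO tier] Greenberg–Stevens at a SPLIT multiplicative `2`**: the exceptional-zero formula
`[T¹]L₂(E,T)·log₂ γ = 𝓛₂(E)·[0]⁺_f` (tree named fact `greenberg_stevens W 2`, stated for every prime; printed proofs cover
`p ≥ 5` (Greenberg–Stevens 1993) and odd `p` (Kobayashi 2006) — at `p = 2` it is the cell's memo PROOF-GS2, referee RC-4 PASS, i.e.
NOT print — hence tagged `@[conjecture]` here, an obligation node, not a Literature fact) for every globally minimal `W` split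
multiplicative at `2`. Needed by the SPLIT half of the converse only (`Theorems.multiplicativeRankZeroTwoConverse_iff_bySign`).
Nothing asserted. [cite: GreenbergStevens1993, Theorem of the Introduction (p ≥ 5; shape only; nothing asserted)]
[cite: Kobayashi2006DocMath, Cor. 4.2 (p. 575; odd p; shape only; nothing asserted)] -/
@[conjecture] def MultGreenbergStevensAtTwo : Prop :=
  ∀ (W : WeierstrassCurve ℚ) [W.IsElliptic] [W.IsGloballyMinimal],
    W.HasSplitMultiplicativeReductionAtPrime 2 → greenberg_stevens (W := W) (p := 2)

/-- **[proposed crux child, member-wise form] The integral EISENSTEIN half of the `2`-adic cyclotomic main conjecture on the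
class «non-CM, multiplicative at `2`»**: for every such globally minimal `W`, `X5.O1.MultEisensteinDivisibilityAtTwo W` (T-mult-4-int:
for the cyclotomic `ℤ₂`-extension, every newform `f` of `W`, `ϖ` with `ϖ·Ω_W = Ω⁺_f`, every dual datum and every generator `f_X`
of `char_Λ X(W/ℚ_∞)`: `ι f_X = ι h · ϖ·L₂` at a NON-SPLIT `2`, `ι(T·f_X) = ι h · ϖ·L₂` at a SPLIT `2`, some `h ∈ ℤ₂⟦T⟧`).
VERBATIM the research object of the K4ᵐ lower-half road (item 19923, `Theorems.multLowerHalfAtTwo_of_multEisenstein_of_cotorsion`):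
one proof serves both axes. Printed only for odd `p` (Skinner 2016 Thm. A/B `p ≥ 3`; Skinner–Urban 2014 `p` odd); nothing at `p = 2`;
nothing asserted. [cite: Skinner2016PacificMC, Thm. A and Thm. B (§1; p ≥ 3; shape only; nothing asserted)] -/
@[conjecture] def MultEisensteinHalfAtTwo : Prop :=
  ∀ (W : WeierstrassCurve ℚ) [W.IsElliptic] [W.IsGloballyMinimal], ¬ W.HasCM → Mult W 2 →
    Summit.BirchSwinnertonDyer.Rank1Residual.X5.O1.MultEisensteinDivisibilityAtTwo W

/-- **[proposed crux child, ISOGENY-HEDGED form ((β) pattern)]**: for every non-CM globally minimal `W` multiplicative at `2`,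
SOME `ℚ`-isogenous globally minimal `W'`, multiplicative at `2`, satisfies `X5.O1.MultEisensteinDivisibilityAtTwo W'`. Weaker than
`MultEisensteinHalfAtTwo` (`multEisensteinHalfAtTwoIso_of_multEisensteinHalfAtTwo`); sufficient for the converse because
`corank_{ℤ₂} Sel_{2^∞}` and `ord_{s=1} L` are isogeny invariants (`Theorems.multiplicativeRankZeroTwoConverse_of_multEisenstein_of_cotorsion_upToIsogeny`,
p432672); it dodges the `μ`-isogeny formula at `p = 2`, which is not in print (Greenberg LNM 1716 p. 64 prints it for odd `p` only).
Nothing asserted. [cite: Skinner2016PacificMC, Thm. A and Thm. B (§1; p ≥ 3; shape only; nothing asserted)]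
[cite: GreenbergLNM1716, §1 p. 64 (isogeny and μ, odd p)] -/
@[conjecture] def MultEisensteinHalfAtTwoIso : Prop :=
  ∀ (W : WeierstrassCurve ℚ) [W.IsElliptic] [W.IsGloballyMinimal], ¬ W.HasCM → Mult W 2 →
    ∃ (W' : WeierstrassCurve ℚ) (_ : W'.IsElliptic) (_ : W'.IsGloballyMinimal),
      IsIsogenous W W' ∧ Mult W' 2 ∧ Summit.BirchSwinnertonDyer.Rank1Residual.X5.O1.MultEisensteinDivisibilityAtTwo W'

/-- The member-wise Eisenstein half implies the isogeny-hedged one (take `W' = W`, `isIsogenous_self`). [folklore] -/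
theorem multEisensteinHalfAtTwoIso_of_multEisensteinHalfAtTwo (h : MultEisensteinHalfAtTwo) :
    MultEisensteinHalfAtTwoIso :=
  fun W _ _ hcm hmult => ⟨W, inferInstance, inferInstance, isIsogenous_self W, hmult, h W hcm hmult⟩

end Summit.BirchSwinnertonDyer.BirchSwinnertonDyer.Theorems.TwoAdicMultCyc

end
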